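import Summits.HodgeConjecture.CorCM.Census.CyclicCharacterIntervalRule

/-!
# Cyclic characters, XLIII: THE CANONICAL SUB-BALANCED LINEARISATION for every `k` under the interval rule

COR-CM (cell `pub-hodgecm2`), count-neutral kernel combinatorics by the binder seat b09 (gen 44; lane CYCLIC-CHARACTER FIBRE LAW, part XLIII — the `k ≥ 3`
version of part XXXVʼs lower-left linearisation, cf. `HOME/pub-hodgecm2-b09/lean-g44/LOWER-RULE-ROADMAP.md`), on parts XXXV (`single_sub_thetaG_mem_of_local`),
XLI and XLII BY NAME.  Theorems only (no definition, no `decide`, no certificate, no named fact, no `sorry`).  HONEST FRAMING: `HC_CM` is NOT proved, here or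
anywhere in the tree; nothing here is a period or a headline.

**THEOREM (`single_sub_thetaG_mem_of_subBalanced`).**  Let `L` have the toward property and obey the INTERVAL RULE outside a block `E` (part XLII: for every
interval datum `(Q, r)` at a type `Z ∉ E` of potential `≥ 2`, a face of `L` flips two deviation places of `Z` from the left end `T_0·Q⁻¹`).  Let `Y` be
SUB-BALANCED toward `T_0` — `x_j(Y) ≤ m` for every `j < h` (`n = 2m`) — with `x_{h−1}(Y) < m`, and suppose no sub-type `Z` of `Y` with `x_0(Z) = m` lies in `E`.
Then `[Y] ≡ [T_0] + Σ_{t ∈ T_0∖Y} ([T_0^{(t)}] − [T_0]) (mod L)`.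
PROOF.  At a sub-type `Z`: if `x_0(Z) < m` then `T_0` is its only nearest arc type (part XLI: `T_t` needs `x_0 = m`, `T_{−t}` needs `x_{h−1} = m`), so the toward
face points to `T_0`; if `x_0(Z) = m` then `(1, r)` with `r` = the number of leading coordinates equal to `m` is an interval datum (`r ≤ h − 1`), and the rule
supplies the face.  Part XXXVʼs one-face-per-type induction concludes.

## References
* [Pohlmann1968] H. Pohlmann, Algebraic cycles on abelian varieties of complex multiplication type, Ann. of Math. 88 (1968), Thm 1.
-/

namespace Summit.HodgeConjecture.CorCM.Census.CyclicCharacter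

open Finset
open Summit.HodgeConjecture.CorCM.Prior.AllgGroup.RfwfAllgGroup
open Summit.HodgeConjecture.CorCM.Census.BlockParity
open Summit.HodgeConjecture.CorCM.Census.Coinvariant
open Summit.HodgeConjecture.CorCM.Census.TwistGeneration
open Summit.HodgeConjecture.CorCM.Census.BaseBlock

noncomputable section

variable {G : Type*} [Group G] [Fintype G] [DecidableEq G] {k : ℕ} {w : G → ZMod (2 ^ k)} {c : G}

/-! ## §1 Coordinates of sub-types -/

/-- For `j < h` the fibre `F_j` lies in `T_0`, so `F_j ∖ X = (T_0 ∖ X) ∩ {w = j}`. [folklore] -/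
theorem fib_sdiff_eq_filter_of_lt (hw : ∀ P Q : G, w (P * Q) = w P + w Q) (hk : 1 ≤ k) (hc2 : c * c = 1) (hwc : w c ≠ 0) (X : CMF G c)
    {j : ℕ} (hj : j < 2 ^ (k - 1)) :
    (univ.filter fun s : G => w s = (j : ZMod (2 ^ k))) \ X.1 = ((arcType hw hk hc2 hwc 0).1 \ X.1).filter fun s => w s = (j : ZMod (2 ^ k)) := by
  ext s
  rw [mem_sdiff, mem_filter, mem_filter, mem_sdiff, mem_arcType_iff_exists hw hk hc2 hwc]
  constructor
  · rintro ⟨⟨-, h⟩, h'⟩; exact ⟨⟨⟨j, hj, by rw [h, zero_add]⟩, h'⟩, h⟩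
  · rintro ⟨⟨-, h'⟩, h⟩; exact ⟨⟨mem_univ _, h⟩, h'⟩

/-- Sub-deviation is coordinatewise on the `T_0` side: `T_0 ∖ Z ⊆ T_0 ∖ Y ⟹ x_j(Z) ≤ x_j(Y)` for `j < h`. [folklore] -/
theorem card_fib_sdiff_le_of_sdiff_subset_of_lt (hw : ∀ P Q : G, w (P * Q) = w P + w Q) (hk : 1 ≤ k) (hc2 : c * c = 1) (hwc : w c ≠ 0)
    {Y Z : CMF G c} (h : (arcType hw hk hc2 hwc 0).1 \ Z.1 ⊆ (arcType hw hk hc2 hwc 0).1 \ Y.1) {j : ℕ} (hj : j < 2 ^ (k - 1)) :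
    ((univ.filter fun s : G => w s = (j : ZMod (2 ^ k))) \ Z.1).card ≤ ((univ.filter fun s : G => w s = (j : ZMod (2 ^ k))) \ Y.1).card := by
  rw [fib_sdiff_eq_filter_of_lt hw hk hc2 hwc Z hj, fib_sdiff_eq_filter_of_lt hw hk hc2 hwc Y hj]
  exact card_le_card (filter_subset_filter _ h)

/-! ## §2 The nearest arc types of a sub-balanced type with `x_{h−1} < m` -/

/-- **The nearest arc types of a sub-balanced type `Z` with `x_{h−1}(Z) < m` are `T_0, …, T_r`**: a base change `T_0·P⁻¹` realises the potential iff
`w P = −t` for some `t ≤ h` with `x_0(Z) = … = x_{t−1}(Z) = m`. [folklore] -/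
theorem bpot_eq_ddist_rt_iff_of_subBalanced (hw : ∀ P Q : G, w (P * Q) = w P + w Q) (hk : 1 ≤ k) (hc2 : c * c = 1) (hwc : w c ≠ 0)
    (h1 : ∃ g₁ : G, w g₁ = 1) {m : ℕ} (hm : 2 * m = (univ.filter fun s : G => w s = 0).card) {Z : CMF G c}
    (hZ : ∀ j : ℕ, j < 2 ^ (k - 1) → ((univ.filter fun s : G => w s = (j : ZMod (2 ^ k))) \ Z.1).card ≤ m)
    (hZtop : ((univ.filter fun s : G => w s = ((2 ^ (k - 1) - 1 : ℕ) : ZMod (2 ^ k))) \ Z.1).card < m) (P : G) :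
    bpot c (arcType hw hk hc2 hwc 0) Z = ddist (rt c P (arcType hw hk hc2 hwc 0)) Z ↔
      ∃ t : ℕ, t ≤ 2 ^ (k - 1) - 1 ∧ (∀ j < t, ((univ.filter fun s : G => w s = (j : ZMod (2 ^ k))) \ Z.1).card = m) ∧ w P = -(t : ZMod (2 ^ k)) := by
  obtain ⟨hb, hposI, hnegI⟩ := bpot_eq_ddist_zero_of_subBalanced hw hk hc2 hwc h1 hm hZ
  have hh1 : 1 ≤ 2 ^ (k - 1) := Nat.one_le_two_pow
  rw [rt_arcType_zero_eq, hb]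
  constructor
  · intro h
    rcases eq_natCast_or_eq_neg_natCast hk (-w P) with ⟨t, ht, e⟩ | ⟨t, ht1, ht, e⟩
    · rw [e] at h
      have hall := ((hposI t ht).mp h.symm)
      have htle : t ≤ 2 ^ (k - 1) - 1 := by
        by_contra hlt
        have hteq : t = 2 ^ (k - 1) := by omega
        have := hall (2 ^ (k - 1) - 1) (by omega)
        omega
      refine ⟨t, htle, hall, ?_⟩
      rw [← neg_neg (w P), e]
    · exfalso
      rw [e] at h
      have hall := ((hnegI t ht.le).mp h.symm) 0 (by omega)
      have e' : -((0 + 1 : ℕ) : ZMod (2 ^ k)) + ((2 ^ (k - 1) : ℕ) : ZMod (2 ^ k)) = ((2 ^ (k - 1) - 1 : ℕ) : ZMod (2 ^ k)) := by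
        rw [Nat.cast_sub hh1]; push_cast; ring
      rw [e'] at hall
      omega
  · rintro ⟨t, ht, hall, hP⟩
    rw [hP, neg_neg]
    exact ((hposI t (by omega)).mpr hall).symm

/-! ## §3 The canonical sub-balanced linearisation -/

/-- **THE CANONICAL SUB-BALANCED LINEARISATION** (every `k`), `thetaG` form — see the file header. [folklore] -/
theorem single_sub_thetaG_mem_of_subBalanced (hw : ∀ P Q : G, w (P * Q) = w P + w Q) (hk : 1 ≤ k) (hc2 : c * c = 1) (hwc : w c ≠ 0)
    (h1 : ∃ g₁ : G, w g₁ = 1) (L : Submodule ℤ (CMF G c →₀ ℤ))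
    (htw : ∀ Φ : CMF G c, 2 ≤ bpot c (arcType hw hk hc2 hwc 0) Φ → ∃ Q t t' : G,
      bpot c (arcType hw hk hc2 hwc 0) Φ = ddist (rt c Q (arcType hw hk hc2 hwc 0)) Φ ∧
        t ∈ (rt c Q (arcType hw hk hc2 hwc 0)).1 \ Φ.1 ∧ t' ∈ (rt c Q (arcType hw hk hc2 hwc 0)).1 \ Φ.1 ∧ t ≠ t' ∧ gface c hc2 Φ t t' ∈ L)
    {m : ℕ} (hm : 2 * m = (univ.filter fun s : G => w s = 0).card) (E : Block c)
    (hrule : ∀ (Z : CMF G c) (Q : G) (r : ℕ), blk c Z ≠ E → 2 ≤ bpot c (arcType hw hk hc2 hwc 0) Z → r + 1 < 2 ^ k →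
      (∀ P : G, bpot c (arcType hw hk hc2 hwc 0) Z = ddist (rt c P (arcType hw hk hc2 hwc 0)) Z ↔ ∃ i : ℕ, i ≤ r ∧ w P = w Q - (i : ZMod (2 ^ k))) →
      ∃ s s' : G, s ∈ (rt c Q (arcType hw hk hc2 hwc 0)).1 \ Z.1 ∧ s' ∈ (rt c Q (arcType hw hk hc2 hwc 0)).1 \ Z.1 ∧ s ≠ s' ∧ gface c hc2 Z s s' ∈ L)
    (Y : CMF G c) (hY : ∀ j : ℕ, j < 2 ^ (k - 1) → ((univ.filter fun s : G => w s = (j : ZMod (2 ^ k))) \ Y.1).card ≤ m)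
    (hYtop : ((univ.filter fun s : G => w s = ((2 ^ (k - 1) - 1 : ℕ) : ZMod (2 ^ k))) \ Y.1).card < m)
    (hE : ∀ Z : CMF G c, (arcType hw hk hc2 hwc 0).1 \ Z.1 ⊆ (arcType hw hk hc2 hwc 0).1 \ Y.1 →
      ((univ.filter fun s : G => w s = 0) \ Z.1).card = m → blk c Z ≠ E) :
    Finsupp.single Y (1 : ℤ) - thetaG c hc2 (arcType hw hk hc2 hwc 0) (typeSum G c (Finsupp.single Y 1)) ∈ L := by
  have hh1 : 1 ≤ 2 ^ (k - 1) := Nat.one_le_two_pow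
  have h2k : 2 ^ k = 2 * 2 ^ (k - 1) := by rw [← pow_succ', Nat.sub_add_cancel hk]
  refine single_sub_thetaG_mem_of_local hc2 L (arcType hw hk hc2 hwc 0) ((arcType hw hk hc2 hwc 0).1 \ Y.1) (fun Z hZ h2 => ?_) _ Y rfl subset_rfl
  -- coordinates of the sub-type `Z`
  have hZc : ∀ j : ℕ, j < 2 ^ (k - 1) → ((univ.filter fun s : G => w s = (j : ZMod (2 ^ k))) \ Z.1).card ≤ m :=
    fun j hj => (card_fib_sdiff_le_of_sdiff_subset_of_lt hw hk hc2 hwc hZ hj).trans (hY j hj)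
  have hZtop : ((univ.filter fun s : G => w s = ((2 ^ (k - 1) - 1 : ℕ) : ZMod (2 ^ k))) \ Z.1).card < m :=
    lt_of_le_of_lt (card_fib_sdiff_le_of_sdiff_subset_of_lt hw hk hc2 hwc hZ (by omega)) hYtop
  obtain ⟨hb, hposI, -⟩ := bpot_eq_ddist_zero_of_subBalanced hw hk hc2 hwc h1 hm hZc
  have h2' : 2 ≤ bpot c (arcType hw hk hc2 hwc 0) Z := by rw [hb]; exact h2
  have hiff := bpot_eq_ddist_rt_iff_of_subBalanced hw hk hc2 hwc h1 hm hZc hZtop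
  by_cases hx0 : ((univ.filter fun s : G => w s = 0) \ Z.1).card = m
  · -- on the edge: the interval datum `(1, r)` and the rule
    set r := Nat.findGreatest (fun t => ∀ j < t, ((univ.filter fun s : G => w s = (j : ZMod (2 ^ k))) \ Z.1).card = m) (2 ^ (k - 1) - 1) with hr
    have hrle : r ≤ 2 ^ (k - 1) - 1 := Nat.findGreatest_le _
    have hrspec : ∀ j < r, ((univ.filter fun s : G => w s = (j : ZMod (2 ^ k))) \ Z.1).card = m :=
      Nat.findGreatest_spec (P := fun t => ∀ j < t, ((univ.filter fun s : G => w s = (j : ZMod (2 ^ k))) \ Z.1).card = m) (Nat.zero_le _)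
        (fun j hj => absurd hj (Nat.not_lt_zero j))
    have hdat : ∀ P : G, bpot c (arcType hw hk hc2 hwc 0) Z = ddist (rt c P (arcType hw hk hc2 hwc 0)) Z ↔
        ∃ i : ℕ, i ≤ r ∧ w P = w (1 : G) - (i : ZMod (2 ^ k)) := by
      intro P
      rw [hiff P, map_one hw]
      constructor
      · rintro ⟨t, ht, hall, hP⟩
        exact ⟨t, Nat.le_findGreatest ht hall, by rw [hP, zero_sub]⟩
      · rintro ⟨i, hi, hP⟩
        exact ⟨i, hi.trans hrle, fun j hj => hrspec j (lt_of_lt_of_le hj hi), by rw [hP, zero_sub]⟩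
    obtain ⟨s, s', hs, hs', hss', hf⟩ := hrule Z 1 r (hE Z hZ hx0) h2' (by omega) hdat
    rw [rt_one] at hs hs'
    exact ⟨s, s', hs, hs', hss', hf⟩
  · -- strictly inside: `T_0` is the only nearest arc type
    obtain ⟨Q, s, s', hQ, hs, hs', hss', hf⟩ := htw Z h2'
    obtain ⟨t, ht, hall, hP⟩ := (hiff Q).mp hQ
    have ht0 : t = 0 := by
      by_contra h
      have := hall 0 (Nat.pos_of_ne_zero h)
      rw [Nat.cast_zero] at this
      exact hx0 this
    rw [ht0, Nat.cast_zero, neg_zero] at hP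
    rw [rt_arcType_zero_eq, hP, neg_zero] at hs hs'
    exact ⟨s, s', hs, hs', hss', hf⟩

/-- **THE CANONICAL SUB-BALANCED LINEARISATION**, normal form. [folklore] -/
theorem single_sub_normalForm_mem_of_subBalanced (hw : ∀ P Q : G, w (P * Q) = w P + w Q) (hk : 1 ≤ k) (hc2 : c * c = 1) (hwc : w c ≠ 0)
    (h1 : ∃ g₁ : G, w g₁ = 1) (L : Submodule ℤ (CMF G c →₀ ℤ))
    (htw : ∀ Φ : CMF G c, 2 ≤ bpot c (arcType hw hk hc2 hwc 0) Φ → ∃ Q t t' : G,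
      bpot c (arcType hw hk hc2 hwc 0) Φ = ddist (rt c Q (arcType hw hk hc2 hwc 0)) Φ ∧
        t ∈ (rt c Q (arcType hw hk hc2 hwc 0)).1 \ Φ.1 ∧ t' ∈ (rt c Q (arcType hw hk hc2 hwc 0)).1 \ Φ.1 ∧ t ≠ t' ∧ gface c hc2 Φ t t' ∈ L)
    {m : ℕ} (hm : 2 * m = (univ.filter fun s : G => w s = 0).card) (E : Block c)
    (hrule : ∀ (Z : CMF G c) (Q : G) (r : ℕ), blk c Z ≠ E → 2 ≤ bpot c (arcType hw hk hc2 hwc 0) Z → r + 1 < 2 ^ k →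
      (∀ P : G, bpot c (arcType hw hk hc2 hwc 0) Z = ddist (rt c P (arcType hw hk hc2 hwc 0)) Z ↔ ∃ i : ℕ, i ≤ r ∧ w P = w Q - (i : ZMod (2 ^ k))) →
      ∃ s s' : G, s ∈ (rt c Q (arcType hw hk hc2 hwc 0)).1 \ Z.1 ∧ s' ∈ (rt c Q (arcType hw hk hc2 hwc 0)).1 \ Z.1 ∧ s ≠ s' ∧ gface c hc2 Z s s' ∈ L)
    (Y : CMF G c) (hY : ∀ j : ℕ, j < 2 ^ (k - 1) → ((univ.filter fun s : G => w s = (j : ZMod (2 ^ k))) \ Y.1).card ≤ m)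
    (hYtop : ((univ.filter fun s : G => w s = ((2 ^ (k - 1) - 1 : ℕ) : ZMod (2 ^ k))) \ Y.1).card < m)
    (hE : ∀ Z : CMF G c, (arcType hw hk hc2 hwc 0).1 \ Z.1 ⊆ (arcType hw hk hc2 hwc 0).1 \ Y.1 →
      ((univ.filter fun s : G => w s = 0) \ Z.1).card = m → blk c Z ≠ E) :
    Finsupp.single Y (1 : ℤ) - ((∑ t ∈ (arcType hw hk hc2 hwc 0).1 \ Y.1,
      (Finsupp.single (oflipCM c hc2 t (arcType hw hk hc2 hwc 0)) (1 : ℤ) - Finsupp.single (arcType hw hk hc2 hwc 0) 1)) +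
        Finsupp.single (arcType hw hk hc2 hwc 0) 1) ∈ L := by
  rw [← thetaG_typeSum_single hc2]
  exact single_sub_thetaG_mem_of_subBalanced hw hk hc2 hwc h1 L htw hm E hrule Y hY hYtop hE

/-- **TRANSPORTED SUB-BALANCED LINEARISATION**: for a `G`-stable `L` and any `g`, `[Y·g⁻¹] − θ_{T_0·g⁻¹}(1_{Y·g⁻¹}) ∈ L`. [folklore] -/
theorem single_sub_thetaG_rt_mem_of_subBalanced (hw : ∀ P Q : G, w (P * Q) = w P + w Q) (hk : 1 ≤ k) (hc2 : c * c = 1) (hwc : w c ≠ 0)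
    (h1 : ∃ g₁ : G, w g₁ = 1) (L : Submodule ℤ (CMF G c →₀ ℤ)) (hLG : ∀ (Q : G) (y : CMF G c →₀ ℤ), y ∈ L → Finsupp.mapDomain (rt c Q) y ∈ L)
    (htw : ∀ Φ : CMF G c, 2 ≤ bpot c (arcType hw hk hc2 hwc 0) Φ → ∃ Q t t' : G,
      bpot c (arcType hw hk hc2 hwc 0) Φ = ddist (rt c Q (arcType hw hk hc2 hwc 0)) Φ ∧
        t ∈ (rt c Q (arcType hw hk hc2 hwc 0)).1 \ Φ.1 ∧ t' ∈ (rt c Q (arcType hw hk hc2 hwc 0)).1 \ Φ.1 ∧ t ≠ t' ∧ gface c hc2 Φ t t' ∈ L)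
    {m : ℕ} (hm : 2 * m = (univ.filter fun s : G => w s = 0).card) (E : Block c)
    (hrule : ∀ (Z : CMF G c) (Q : G) (r : ℕ), blk c Z ≠ E → 2 ≤ bpot c (arcType hw hk hc2 hwc 0) Z → r + 1 < 2 ^ k →
      (∀ P : G, bpot c (arcType hw hk hc2 hwc 0) Z = ddist (rt c P (arcType hw hk hc2 hwc 0)) Z ↔ ∃ i : ℕ, i ≤ r ∧ w P = w Q - (i : ZMod (2 ^ k))) →
      ∃ s s' : G, s ∈ (rt c Q (arcType hw hk hc2 hwc 0)).1 \ Z.1 ∧ s' ∈ (rt c Q (arcType hw hk hc2 hwc 0)).1 \ Z.1 ∧ s ≠ s' ∧ gface c hc2 Z s s' ∈ L)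
    (Y : CMF G c) (hY : ∀ j : ℕ, j < 2 ^ (k - 1) → ((univ.filter fun s : G => w s = (j : ZMod (2 ^ k))) \ Y.1).card ≤ m)
    (hYtop : ((univ.filter fun s : G => w s = ((2 ^ (k - 1) - 1 : ℕ) : ZMod (2 ^ k))) \ Y.1).card < m)
    (hE : ∀ Z : CMF G c, (arcType hw hk hc2 hwc 0).1 \ Z.1 ⊆ (arcType hw hk hc2 hwc 0).1 \ Y.1 →
      ((univ.filter fun s : G => w s = 0) \ Z.1).card = m → blk c Z ≠ E) (g : G) :
    Finsupp.single (rt c g Y) (1 : ℤ) - thetaG c hc2 (rt c g (arcType hw hk hc2 hwc 0)) (typeSum G c (Finsupp.single (rt c g Y) 1)) ∈ L := by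
  have h := hLG g _ (single_sub_thetaG_mem_of_subBalanced hw hk hc2 hwc h1 L htw hm E hrule Y hY hYtop hE)
  rwa [Finsupp.mapDomain_sub, Finsupp.mapDomain_single, mapDomain_rt_thetaG] at h

end

end Summit.HodgeConjecture.CorCM.Census.CyclicCharacter
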